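import Summits.AnomalousDissipation.AnomalousDissipation.Theorems.MarginalStabilityChainStrainedLayerLawParallelRelax
import Summits.AnomalousDissipation.AnomalousDissipation.Theorems.MarginalStabilityChainStrainedLayerLawClockLine
import HarnessLib

/-!
# Crux `MarginalStabilityChain.StrainedLayerLaw` (stmt-AnomalousDissipation-3007), line `FirstLemmasR2K4`:
# local finiteness and the exact Cesàro mean of the dissipation of the EXPLICIT parallel member

Support file (`--supports stmt-AnomalousDissipation-3007`; registered sub-goals `parallelMember_finiteDissipation` and
`meanLayerDissipation_parallelMember` of line `FirstLemmasR2K4`, lead c6, wave 1).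

What it proves, for the explicit parallel member `u = U_B^ν(y) + P(t,y)`, `v = 0` of `…ParallelRelaxMember.lean` /
`…ParallelRelax.lean` (lead c5; `P(t,y) = ∫ G₁(z) g(eᵗy − √s(t) z) dz`, `s(t) = ν(e^{2t} − 1)/2`, `g ∈ C²_c(ℝ)`):
* `parallelMember_finiteDissipation`: `∫⁻_{(0,T]} layerDissipation ν L (u t) 0 ≠ ⊤` for every `T > 0` — on `(0, T]` the
  integrand is `ofReal (d t)` (`layerDissipation_member`) with `d t ≤ M` (`pdiss_le`), so the lower integral is at most
  `ofReal M · volume (Ioc 0 T) < ⊤`;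
* `meanLayerDissipation_parallelMember`: `meanLayerDissipation ν L u 0 = ofReal (√ν/(2√π))` — verbatim the Cesàro step of
  the landed `parallelMember_meanLayerDissipation` (`stub_cesaroMean` fed by `pdiss_le`, `pdiss_nonneg`, `tendsto_pdiss`,
  `layerDissipation_member`), with the member written out instead of hidden behind `∃`.
No definitions (the file-local notations `sdiff[…]`, `pdiss[…]` of `…ParallelRelax.lean` abbreviate the explicit
formulas); no facts are asserted.
-/

-- `Summit.<Summit>.<Problem>` is the tree's mandated summit-side namespace (CONVENTIONS §2); for this
-- single-conjunct summit the two coincide, so the duplicate is deliberate.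
set_option linter.dupNamespace false

noncomputable section

open scoped Topology ENNReal
open Filter Set Function MeasureTheory

namespace Summit.AnomalousDissipation.AnomalousDissipation.Theorems.StrainedLayerLaw.LogEnstrophyClock

open Literature.Analysis.FluidPDE Literature.Analysis.FluidPDE.StretchedLayer
open Literature.Analysis.UnboundedOperators
open Summit.AnomalousDissipation.AnomalousDissipation.Theses.MarginalStabilityChain
open Summit.AnomalousDissipation.AnomalousDissipation.Theorems.StrainedLayerLaw.StrainWorkSumRule
open Summit.AnomalousDissipation.AnomalousDissipation.Theorems.StrainedLayerLaw.ParallelRelax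

/-! File-local NOTATION (no definitions; as in `…ParallelRelaxMember.lean` / `…ParallelRelax.lean`):
* `sdiff[ν, g, t, y] = ∫ G₁(z) g(eᵗy − √(ν(e^{2t} − 1)/2)·z) dz` (the strained shear diffusion);
* `pdiss[ν, g, t] = ν ∫ (U_B′(y) + eᵗ (e^{s(t)Δ}g)′(eᵗy))² dy` — the real slice dissipation of the parallel member for `t > 0`. -/
local notation3 (prettyPrint := false) "sdiff[" ν ", " g ", " t ", " y "]" =>
  ∫ z, heatKernel 1 z * g (Real.exp t * y - Real.sqrt (ν * (Real.exp (2 * t) - 1) / 2) * z)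
local notation3 (prettyPrint := false) "pdiss[" ν ", " g ", " t "]" =>
  ν * ∫ y, (burgersLayerProfileD 1 ν 1 y +
    Real.exp t * deriv (heatExtension g (ν * (Real.exp (2 * t) - 1) / 2)) (Real.exp t * y)) ^ 2

/-- **Local finiteness of the dissipation of the explicit parallel member (registered sub-goal).** For `ν > 0`,
`L > 0`, `g ∈ C²_c(ℝ)` and `T > 0`: `∫⁻_{t ∈ (0,T]} layerDissipation ν L (U_B + P(t,·)) 0 ≠ ⊤`. On `(0, T]` the integrand
equals `ofReal (d t)` (`layerDissipation_member`) and `d t ≤ M` uniformly (`pdiss_le`), whence the lower integral is at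
most `ofReal M · volume (Ioc 0 T) = ofReal M · ofReal T < ⊤`. [folklore] -/
theorem parallelMember_finiteDissipation :
    ∀ (ν L : ℝ) (g : ℝ → ℝ), 0 < ν → 0 < L → ContDiff ℝ 2 g → HasCompactSupport g → ∀ T : ℝ, 0 < T →
      ∫⁻ t in Ioc 0 T, layerDissipation ν L
        (fun (_ : ℝ) y => burgersLayerProfile 1 ν 1 y +
          ∫ z, heatKernel 1 z * g (Real.exp t * y - Real.sqrt (ν * (Real.exp (2 * t) - 1) / 2) * z))
        (fun _ _ => 0) ≠ ∞ := by
  intro ν L g hν hL hg hc T _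
  obtain ⟨M, hM⟩ := pdiss_le hν hg hc
  -- on `(0, T]` the integrand is `ofReal (d t) ≤ ofReal M`
  have h1 : ∫⁻ t in Ioc 0 T, layerDissipation ν L
        (fun (_ : ℝ) y => burgersLayerProfile 1 ν 1 y + sdiff[ν, g, t, y]) (fun _ _ => 0) =
      ∫⁻ t in Ioc 0 T, ENNReal.ofReal (pdiss[ν, g, t]) :=
    setLIntegral_congr_fun measurableSet_Ioc fun t ht => layerDissipation_member hν hL hg hc ht.1
  have h2 : ∫⁻ t in Ioc 0 T, ENNReal.ofReal (pdiss[ν, g, t]) ≤ ∫⁻ _ in Ioc 0 T, ENNReal.ofReal M :=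
    setLIntegral_mono' measurableSet_Ioc fun t ht => ENNReal.ofReal_le_ofReal (hM t ht.1)
  have h3 : ∫⁻ _ in Ioc 0 T, ENNReal.ofReal M = ENNReal.ofReal M * volume (Ioc 0 T) := setLIntegral_const _ _
  have h4 : ENNReal.ofReal M * volume (Ioc 0 T) ≠ ∞ := by
    rw [Real.volume_Ioc]
    exact ENNReal.mul_ne_top ENNReal.ofReal_ne_top ENNReal.ofReal_ne_top
  rw [h1]
  exact ne_top_of_le_ne_top h4 (h2.trans h3.le)

/-- **The Cesàro mean of the dissipation of the explicit parallel member (registered sub-goal).** For `ν > 0`, `L > 0`,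
`g ∈ C²_c(ℝ)`: `meanLayerDissipation ν L (U_B + P) 0 = ofReal (√ν/(2√π))` — the Sweet–Parker rung. With
`d t = pdiss t` for `t > 0` (and `0` otherwise): `d ≥ 0` (`pdiss_nonneg`), `d ≤ M` on `(0, ∞)` (`pdiss_le`),
`d → √ν/(2√π)` (`tendsto_pdiss`), so `stub_cesaroMean` computes the `liminf` of the Cesàro means of `ofReal (d t)`, and
on `(0, T]` these are the member's `layerDissipation` (`layerDissipation_member`). Verbatim the Cesàro step of the landed
`parallelMember_meanLayerDissipation`. [folklore] -/
theorem meanLayerDissipation_parallelMember :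
    ∀ (ν L : ℝ) (g : ℝ → ℝ), 0 < ν → 0 < L → ContDiff ℝ 2 g → HasCompactSupport g →
      meanLayerDissipation ν L
        (fun t (_ : ℝ) y => burgersLayerProfile 1 ν 1 y +
          ∫ z, heatKernel 1 z * g (Real.exp t * y - Real.sqrt (ν * (Real.exp (2 * t) - 1) / 2) * z))
        (fun _ _ _ => 0) = ENNReal.ofReal (Real.sqrt ν / (2 * Real.sqrt Real.pi)) := by
  intro ν L g hν hL hg hc
  obtain ⟨M, hM⟩ := pdiss_le hν hg hc
  set d : ℝ → ℝ := fun t => if 0 < t then pdiss[ν, g, t] else 0 with hd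
  have hd0 : ∀ t, 0 ≤ d t := fun t => by
    simp only [hd]
    split_ifs
    · exact pdiss_nonneg hν.le g t
    · exact le_rfl
  have hdM : ∀ t, 0 < t → d t ≤ M := fun t ht => by
    simp only [hd, if_pos ht]
    exact hM t ht
  have hdK : Tendsto d atTop (𝓝 (Real.sqrt ν / (2 * Real.sqrt Real.pi))) := by
    refine (tendsto_pdiss hν hg hc).congr' ?_
    filter_upwards [eventually_gt_atTop 0] with t ht
    simp only [hd, if_pos ht]
  have hK0 : 0 ≤ Real.sqrt ν / (2 * Real.sqrt Real.pi) := by positivity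
  have hces := stub_cesaroMean d _ M hK0 hd0 hdM hdK
  rw [meanLayerDissipation_def, ← hces]
  refine Filter.liminf_congr (Eventually.of_forall fun T => ?_)
  congr 1
  refine setLIntegral_congr_fun measurableSet_Ioc fun t ht => ?_
  simp only [hd, if_pos ht.1]
  exact layerDissipation_member hν hL hg hc ht.1

end Summit.AnomalousDissipation.AnomalousDissipation.Theorems.StrainedLayerLaw.LogEnstrophyClock

end
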